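import Literature.NumberTheory.ComplexMultiplication.ReflexDegreeMaximal
import Literature.NumberTheory.ComplexMultiplication.ReflexDegreeQuadraticSubfieldBound
import HarnessLib

/-!
# The orbit partition of the reflex degrees: `Σ_Φ [K′_Φ : ℚ] = 2ⁿ` (Dodson 1984 §1.3, §4.0; Kida 2019 Rem. 4.3)

The `2ⁿ` CM types of a CM field `K` of degree `2n` (Dodson 1984 §1.2) fall into classes under the Galois group
`G = Gal(L/ℚ)` of a Galois CM field `L ⊇ K`, and the class of `Φ` has `[K′_Φ : ℚ]` members, `K′_Φ` the reflex
field: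

* B. Dodson, *The structure of Galois groups of CM-fields*, Trans. AMS **283** (1984) 1–32 [Dodson1984] (held
  `paper:doi-10-2307-1999987`), §1.3, the Reflex Degree Theorem and the **Remark (p. 5): "Note that `[K′ : ℚ]` is
  also the order of the orbit of `Φ` under the `G`-action"**; §4.0 (p. 17): "the general partition formula for
  the degrees of the reflex fields, `2ᵖ = 2ᵛ + (2ᵛp)(Σ_c 1)` … has been established in the proof" (the case
  `G = (ℤ₂)ᵛ ⋊ ℤₚ`), §4.1 Proposition: "the partition giving the degrees of the reflex fields" (the case `D₂ₙ`);
* M. Kida, *Counting formulas for CM-types*, Moscow J. Combin. Number Theory **8** (2019) 343–355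
  [Kida2019CountingCMTypes] (held `paper:doi-10-2140-moscow-2019-8-343`), **Remark 4.3 (p. 350)**: "For each
  `K ∈ 𝓗`, we see `[L_K : ℚ] = |G|/|K|`, where `L_K` is the reflex field. Hence the sum of `[L_K : ℚ]` over a
  representative of the conjugacy classes of `CM(G, H, ρ)` is `2^{½|H\G|}`. This fact was previously noticed by
  Dodson [1984, p. 5] and Oishi-Tomiyasu [2010, Lemma 1.4]."

So for EVERY CM field the reflex degrees of a system of representatives of the Galois classes of CM types form a
partition of `2ⁿ`:  **`Σ_{classes} [K′_Φ : ℚ] = 2ⁿ`**.  The tree has the two ends of this identity — the special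
partitions `2ᵖ = 2ᵛ + (2ᵛp)c` (`PairKernelPrimeIndex`) and the single class `2ⁿ = 2ⁿ` of the case `v = n`
(`ReflexDegreeMaximal`) — and the ingredients (`finrank_reflexField_eq_card_orbit`: `[K′ : ℚ] = |G·Φ|`;
`IsCMTypeWith.natCard_setOf_isCMTypeWith`: `2ⁿ` CM types); this file proves the general identity, at group level
and for number fields, together with its first consequences.  (At the level of Kida's triples `(G, H, ρ)` — CM
types as half-systems `S ⊆ G` — the companion statement `Σ_{classes} (G : r(S)) = 2^{½(G:H)}` is
`CMTypeCounting.sum_index_leftStab_out_eq_two_pow` in `CMTypeCountingFormulas`.)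

## Contents (everything PROVED; theorems only — no definition, no named fact, net debt 0)

§1 (private): a `G`-stable family is the disjoint union of the orbits through a system of representatives
(`#{P} = Σ_{t ∈ T} |G·t|`), and such a system exists.

§2 GROUP LEVEL (`G` acting on `E`, `ρ ∈ G`, CM types `IsCMTypeWith ρ Φ` as in `CMTypeRank`), for a system of
representatives `T` of the `G`-classes of CM types:
* `IsCMTypeWith.natCard_setOf_eq_sum_card_orbit` — `#{CM types} = Σ_{Ψ ∈ T} |G·Ψ|`;
* **`IsCMTypeWith.sum_card_orbit_eq_two_pow`** — `Σ_{Ψ ∈ T} |G·Ψ| = 2ⁿ`, `n = |E|/2`; Kida's index form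
  `IsCMTypeWith.sum_index_stabilizer_eq_two_pow` — `Σ_{Ψ ∈ T} (G : Stab Ψ) = 2ⁿ`;
* `IsCMTypeWith.exists_orbitTransversal` — a system of representatives exists;
* `IsCMTypeWith.card_orbit_eq_two_pow_iff` / `…_iff_forall` — **one class iff `|G·Φ| = 2ⁿ`** (Dodson §5.1.3);
  `IsCMTypeWith.card_orbit_lt_two_pow_of_one_lt_card` — with `≥ 2` classes every orbit is shorter than `2ⁿ`;
  `IsCMTypeWith.card_le_two_pow_and_two_pow_le_card_mul` — the number `c` of classes has `c ≤ 2ⁿ ≤ c·|G|`;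
* `IsCMTypeWith.card_mul_card_eq_sum_card_stabilizer` — the number of classes by Burnside–Frobenius,
  `c·|G| = Σ_{Ψ a CM type} |Stab Ψ|` (Kida's Theorem 4.1 `c(G,H,ρ)·|G| = Σ_S |r(S)|`, read on `G`-sets).

§3 NUMBER FIELDS, Galois formulation `(W_L)` (`K` totally complex of degree `2n`, `L ⊇ K` a Galois CM field —
e.g. a normal closure —, `ρ = conjGal`, CM types `Φ ⊆ Hom_ℚ(K, L)` with `IsCMTypeWith conjGal Φ`, reflex field
`K′_Φ = reflexField ℚ L Φ`):
* `natCard_isCMTypeWith_conjGal` — `#{CM types of K in (W_L)} = 2ⁿ`; `finrank_reflexField_eq_index_stabilizer` —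
  `[K′_Φ : ℚ] = (Gal(L/ℚ) : Stab Φ)` («`[L_K : ℚ] = |G|/|K|`»);
* **`sum_finrank_reflexField_eq_two_pow`** — THE PARTITION `Σ_{Φ ∈ T} [K′_Φ : ℚ] = 2ⁿ` for every system of
  representatives `T` of the Galois classes of CM types; `sum_index_stabilizer_conjGal_eq_two_pow` (index form);
  `exists_orbitTransversal_conjGal`;
* `finrank_reflexField_eq_two_pow_iff` — **`[K′_Φ : ℚ] = 2ⁿ` iff all CM types of `K` are Galois conjugate to
  `Φ`**; `card_le_two_pow_and_two_pow_le_card_mul_finrank` — `c ≤ 2ⁿ ≤ c·[L : ℚ]` for the number `c` of classes;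
  `card_mul_finrank_eq_sum_finrank_reflexField` — **`c·[L : ℚ] = Σ_{Φ a CM type} [L : K′_Φ]`** (Kida Thm. 4.1);
* for the tree's complex CM types `Φ : CMType K` read in `L` through `ι : L → ℂ` (`algValuedIn ι Φ`, the
  dictionary `cmTypeEquivIsCMTypeWithGal`): **`sum_finrank_reflexField_algValuedIn_eq_two_pow`** and
  `finrank_reflexField_algValuedIn_eq_two_pow_iff`.

§4 ONE GALOIS CLASS ⟹ NONDEGENERATE (Ribet's Cor. (3.6) «`d′ = 2^{d−1}` ⟹ non-degenerate», the tree's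
`isNondegenerate_of_finrank_reflexField_eq`, read through §3): `exists_smul_algValuedIn_eq_of_smul_eq` /
`exists_smul_eq_of_smul_algValuedIn_eq` (`Aut(ℂ)`-conjugacy of complex types = `Gal(L/ℚ)`-conjugacy of their
readings in `L`); **`isNondegenerate_of_forall_exists_smul_eq`** — if all complex CM types of `K` are
`Aut(ℂ)`-conjugate to one of them, EVERY CM type of `K` is nondegenerate; `isNondegenerate_of_finrank_reflexField_eq_two_pow`
(one type with `[K*_Φ : ℚ] = 2ⁿ` ⟹ all types nondegenerate); and on abelian varieties
**`hodgeClassSpan_pow_eq_divisorClassesSpan_of_forall_exists_smul_eq`** (`Bᵐ(Aᵏ) ⊗ ℂ = Dᵐ(Aᵏ) ⊗ ℂ`: no exceptional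
Hodge classes on any power of any abelian variety with CM by such a `K`),
**`hodgeConjectureFor_pow_of_forall_exists_smul_eq`**, `hodgeConjectureFor_of_forall_exists_smul_eq`.

## References

* [Dodson1984] B. Dodson, Trans. AMS 283 (1984): §1.2 Proposition, §1.3 Reflex Degree Theorem and Remark (p. 5),
  §4.0 (p. 17), §4.1 Proposition, §5.1.3 Proposition 1 (proof, p. 20).
* [Kida2019CountingCMTypes] M. Kida, Moscow J. Combin. Number Theory 8 (2019): Remark 4.3 (p. 350), Theorem 4.1 and
  Proposition 4.2 (p. 349: «`c(G,H,ρ) = |G|⁻¹ Σ_{K∈𝓗} |K|·|𝒮̄(H) ∩ ℛ(K)|`», by «the lemma of Burnside and Frobenius»).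
* [Shimura1998] G. Shimura, *Abelian varieties with complex multiplication and modular functions*, §8.3 Prop. 28
  (`[K′ : ℚ] = (G : H*)`, through the tree's `finrank_reflexField_eq_card_orbit`), §32.7.
* [Ribet1980] K. A. Ribet, *Division fields of abelian varieties with complex multiplication*, Mém. SMF (2) 2
  (1980), §3 Cor. (3.6) (p. 87) (through the tree's `isNondegenerate_of_finrank_reflexField_eq`).
* [Gordon1999HodgeAVSurvey] B. B. Gordon, *A survey of the Hodge conjecture for abelian varieties*, Thm. 6.4, §9.3
  (nondegenerate ⟹ `Hdg = Div` on all powers; the tree's `Pohlmann1968/NondegenerateCMTypeHodgeConjecture`).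
-/

set_option autoImplicit false

open scoped Pointwise

namespace Literature.NumberTheory.ComplexMultiplication

/-! ## §1 A stable family is the disjoint union of the classes of a system of representatives -/

section Transversal

variable {G : Type*} [Group G] {α : Type*} [MulAction G α]

/-- If `P` is `G`-stable and `T ⊆ {P}` is a system of representatives of the `G`-classes in `{x | P x}` (every `x`
with `P x` is a translate of exactly one `t ∈ T`), then `{x | P x} = ⨆_{t ∈ T} G·t`:
`#{x | P x} = Σ_{t ∈ T} |G·t|`. [folklore] -/
private theorem natCard_subtype_eq_sum_card_orbit {P : α → Prop} (hP : ∀ (g : G) (x : α), P x → P (g • x))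
    {T : Finset α} (hT : ∀ t ∈ T, P t) (huniq : ∀ x, P x → ∃! t, t ∈ T ∧ x ∈ MulAction.orbit G t)
    [∀ t : α, Finite (MulAction.orbit G t)] :
    Nat.card {x // P x} = ∑ t ∈ T, Nat.card (MulAction.orbit G t) := by
  classical
  have hrep : ∀ x : {x // P x}, ∃ t, (t ∈ T ∧ (x : α) ∈ MulAction.orbit G t) ∧
      ∀ t', (t' ∈ T ∧ (x : α) ∈ MulAction.orbit G t') → t' = t := fun x => huniq x.1 x.2
  choose rep hrep hrep' using hrep
  let e : {x // P x} ≃ Σ t : T, MulAction.orbit G (t : α) :=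
    { toFun := fun x => ⟨⟨rep x, (hrep x).1⟩, ⟨(x : α), (hrep x).2⟩⟩
      invFun := fun y => ⟨(y.2 : α), by
        obtain ⟨g, hg⟩ := MulAction.mem_orbit_iff.1 y.2.2
        rw [← hg]
        exact hP g _ (hT _ y.1.2)⟩
      left_inv := fun x => Subtype.ext rfl
      right_inv := fun y => by
        obtain ⟨⟨t, ht⟩, ⟨z, hz⟩⟩ := y
        apply Sigma.subtype_ext
        · exact Subtype.ext (hrep' _ t ⟨ht, hz⟩).symm
        · rfl }
  rw [Nat.card_congr e, Nat.card_sigma, Finset.sum_coe_sort T (fun t => Nat.card (MulAction.orbit G t))]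

/-- A system of representatives of the `G`-classes in a stable family exists (one point in each class).
[folklore] -/
private theorem exists_transversal [Finite α] {P : α → Prop} (hP : ∀ (g : G) (x : α), P x → P (g • x)) :
    ∃ T : Finset α, (∀ t ∈ T, P t) ∧ ∀ x, P x → ∃! t, t ∈ T ∧ x ∈ MulAction.orbit G t := by
  classical
  haveI : Fintype α := Fintype.ofFinite α
  let out : α → α := fun x => (Quotient.mk (MulAction.orbitRel G α) x).out
  have hout : ∀ x, out x ∈ MulAction.orbit G x := fun x =>
    MulAction.orbitRel_apply.1 (Quotient.exact (Quotient.out_eq (Quotient.mk (MulAction.orbitRel G α) x)))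
  refine ⟨(Finset.univ.filter P).image out, ?_, ?_⟩
  · intro t ht
    obtain ⟨x, hx, rfl⟩ := Finset.mem_image.1 ht
    obtain ⟨g, hg⟩ := MulAction.mem_orbit_iff.1 (hout x)
    rw [← hg]
    exact hP g x (Finset.mem_filter.1 hx).2
  · intro x hx
    refine ⟨out x, ⟨Finset.mem_image.2 ⟨x, Finset.mem_filter.2 ⟨Finset.mem_univ _, hx⟩, rfl⟩,
      (MulAction.orbit_eq_iff.2 (hout x)).symm ▸ MulAction.mem_orbit_self x⟩, ?_⟩
    rintro t ⟨ht, hxt⟩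
    obtain ⟨y, -, rfl⟩ := Finset.mem_image.1 ht
    -- `x ∈ G·out(y)` and `out y ∈ G·y`, so `⟦x⟧ = ⟦y⟧` and `out x = out y`
    have h1 : MulAction.orbit G x = MulAction.orbit G y :=
      (MulAction.orbit_eq_iff.2 hxt).trans (MulAction.orbit_eq_iff.2 (hout y))
    have h2 : (Quotient.mk (MulAction.orbitRel G α) x) = Quotient.mk (MulAction.orbitRel G α) y :=
      Quotient.sound (MulAction.orbitRel_apply.2 (h1 ▸ MulAction.mem_orbit_self x))
    change (Quotient.mk (MulAction.orbitRel G α) y).out = (Quotient.mk (MulAction.orbitRel G α) x).out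
    rw [h2]

end Transversal


/-! ## §2 Group level: the CM types of a `ρ`-structure, partitioned into `G`-classes -/

section GroupLevel

variable {G : Type*} [Group G] {E : Type*} [MulAction G E] {ρ : G} {Φ : Set E}

namespace IsCMTypeWith

/-- **The CM types split into the classes of a system of representatives**: if `T` is a system of
representatives of the `G`-classes of CM types (for `ρ`) — every CM type `Ψ` is a translate `gΦ` of exactly one
`Φ ∈ T` — then `#{CM types} = Σ_{Φ ∈ T} |G·Φ|` (Kida: the CM types counted "over a representative of the
conjugacy classes"). [cite: Kida2019CountingCMTypes, Rem. 4.3] -/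
theorem natCard_setOf_eq_sum_card_orbit [Finite E] {T : Finset (Set E)} (hT : ∀ Φ ∈ T, IsCMTypeWith ρ Φ)
    (huniq : ∀ Ψ : Set E, IsCMTypeWith ρ Ψ → ∃! Φ, Φ ∈ T ∧ Ψ ∈ MulAction.orbit G Φ) :
    Nat.card {Ψ : Set E // IsCMTypeWith ρ Ψ} = ∑ Φ ∈ T, Nat.card (MulAction.orbit G Φ) :=
  natCard_subtype_eq_sum_card_orbit (fun g _ hΨ => hΨ.smul_set g) hT huniq

/-- **`Σ_{classes} |G·Φ| = 2ⁿ`** (`n = |E|/2` pairs `{x, ρx}`): the orbit lengths of a system of representatives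
of the `G`-classes of CM types add up to the number `2ⁿ` of all CM types («the sum of `[L_K : ℚ]` over a
representative of the conjugacy classes of `CM(G, H, ρ)` is `2^{½|H\G|}`», with `[L_K : ℚ] = |G|/|K|` the orbit
length; Dodson's «general partition formula for the degrees of the reflex fields»).
[cite: Kida2019CountingCMTypes, Rem. 4.3] [cite: Dodson1984, §4.0 (p. 17)] -/
theorem sum_card_orbit_eq_two_pow [Finite E] (h : IsCMTypeWith ρ Φ) {T : Finset (Set E)}
    (hT : ∀ Ψ ∈ T, IsCMTypeWith ρ Ψ)
    (huniq : ∀ Ψ : Set E, IsCMTypeWith ρ Ψ → ∃! Ψ₀, Ψ₀ ∈ T ∧ Ψ ∈ MulAction.orbit G Ψ₀) :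
    ∑ Ψ ∈ T, Nat.card (MulAction.orbit G Ψ) = 2 ^ (Nat.card E / 2) := by
  rw [← natCard_setOf_eq_sum_card_orbit hT huniq, h.natCard_setOf_isCMTypeWith]

/-- The same with the orbit lengths written as indices of stabilisers, `Σ_{classes} (G : Stab Ψ) = 2ⁿ` — Kida's
`Σ (G : r(S)) = 2^{½|H\G|}` (`r(S) = Stab(S)` the reflex subgroup, `[L_K : ℚ] = |G|/|K|`).
[cite: Kida2019CountingCMTypes, Rem. 4.3] -/
theorem sum_index_stabilizer_eq_two_pow [Finite E] (h : IsCMTypeWith ρ Φ) {T : Finset (Set E)}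
    (hT : ∀ Ψ ∈ T, IsCMTypeWith ρ Ψ)
    (huniq : ∀ Ψ : Set E, IsCMTypeWith ρ Ψ → ∃! Ψ₀, Ψ₀ ∈ T ∧ Ψ ∈ MulAction.orbit G Ψ₀) :
    ∑ Ψ ∈ T, (MulAction.stabilizer G Ψ).index = 2 ^ (Nat.card E / 2) := by
  simp_rw [MulAction.index_stabilizer, ← Nat.card_coe_set_eq]
  exact h.sum_card_orbit_eq_two_pow hT huniq

/-- A system of representatives of the `G`-classes of CM types exists. [cite: Kida2019CountingCMTypes, Rem. 4.3] -/
theorem exists_orbitTransversal [Finite E] :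
    ∃ T : Finset (Set E), (∀ Ψ ∈ T, IsCMTypeWith ρ Ψ) ∧
      ∀ Ψ : Set E, IsCMTypeWith ρ Ψ → ∃! Ψ₀, Ψ₀ ∈ T ∧ Ψ ∈ MulAction.orbit G Ψ₀ :=
  exists_transversal (fun g _ hΨ => hΨ.smul_set g)

/-- **A single class iff the orbit is as large as possible**: `|G·Φ| = 2ⁿ` iff EVERY CM type is a translate of
`Φ` (the orbit always lies inside the `2ⁿ` CM types; «the maximal degree `[K′ : ℚ] = 2ⁿ`», «the case `v = n`
gives a single orbit»). [cite: Dodson1984, §5.1.3 Proposition 1 (proof)] -/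
theorem card_orbit_eq_two_pow_iff [Finite E] (h : IsCMTypeWith ρ Φ) :
    Nat.card (MulAction.orbit G Φ) = 2 ^ (Nat.card E / 2) ↔
      MulAction.orbit G Φ = {Ψ : Set E | IsCMTypeWith ρ Ψ} := by
  constructor
  · intro hc
    apply Set.eq_of_subset_of_ncard_le h.orbit_subset_setOf_isCMTypeWith ?_ (Set.toFinite _)
    rw [← Nat.card_coe_set_eq, ← Nat.card_coe_set_eq, hc]
    exact (h.natCard_setOf_isCMTypeWith).le
  · intro he
    rw [Nat.card_congr (Equiv.setCongr he)]
    exact h.natCard_setOf_isCMTypeWith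

/-- Membership form: `|G·Φ| = 2ⁿ` iff every CM type `Ψ` is `gΦ` for some `g ∈ G`.
[cite: Dodson1984, §5.1.3 Proposition 1 (proof)] -/
theorem card_orbit_eq_two_pow_iff_forall [Finite E] (h : IsCMTypeWith ρ Φ) :
    Nat.card (MulAction.orbit G Φ) = 2 ^ (Nat.card E / 2) ↔
      ∀ Ψ : Set E, IsCMTypeWith ρ Ψ → ∃ g : G, g • Φ = Ψ := by
  rw [h.card_orbit_eq_two_pow_iff]
  constructor
  · intro he Ψ hΨ
    have hmem : Ψ ∈ MulAction.orbit G Φ := by rw [he]; exact hΨ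
    exact MulAction.mem_orbit_iff.1 hmem
  · intro hall
    exact Set.Subset.antisymm h.orbit_subset_setOf_isCMTypeWith fun Ψ hΨ => MulAction.mem_orbit_iff.2 (hall Ψ hΨ)

/-- With several classes every orbit is SHORTER than `2ⁿ`: if `T` is a system of representatives with at least two
members then `|G·Ψ| < 2ⁿ` for every `Ψ ∈ T`. [cite: Dodson1984, §4.0 (p. 17)] -/
theorem card_orbit_lt_two_pow_of_one_lt_card [Finite E] (h : IsCMTypeWith ρ Φ) {T : Finset (Set E)}
    (hT : ∀ Ψ ∈ T, IsCMTypeWith ρ Ψ)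
    (huniq : ∀ Ψ : Set E, IsCMTypeWith ρ Ψ → ∃! Ψ₀, Ψ₀ ∈ T ∧ Ψ ∈ MulAction.orbit G Ψ₀) (hcard : 1 < T.card)
    {Ψ : Set E} (hΨ : Ψ ∈ T) : Nat.card (MulAction.orbit G Ψ) < 2 ^ (Nat.card E / 2) := by
  classical
  rw [← h.sum_card_orbit_eq_two_pow hT huniq, ← Finset.add_sum_erase T _ hΨ]
  obtain ⟨Ψ', hΨ', hne⟩ : ∃ Ψ' ∈ T, Ψ' ≠ Ψ := Finset.exists_mem_ne hcard Ψ
  haveI : Nonempty (MulAction.orbit G Ψ') := ⟨⟨Ψ', MulAction.mem_orbit_self Ψ'⟩⟩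
  have hpos : 0 < Nat.card (MulAction.orbit G Ψ') := Nat.card_pos
  have hle : Nat.card (MulAction.orbit G Ψ') ≤ ∑ x ∈ T.erase Ψ, Nat.card (MulAction.orbit G x) :=
    Finset.single_le_sum (f := fun x => Nat.card (MulAction.orbit G x)) (fun _ _ => Nat.zero_le _)
      (Finset.mem_erase.2 ⟨hne, hΨ'⟩)
  omega

/-- Consequently the number `c = |T|` of classes satisfies `c ≤ 2ⁿ ≤ c·|G|` (every orbit has between `1` and
`|G|` members). [cite: Kida2019CountingCMTypes, Rem. 4.3] -/
theorem card_le_two_pow_and_two_pow_le_card_mul [Finite E] [Finite G] (h : IsCMTypeWith ρ Φ)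
    {T : Finset (Set E)} (hT : ∀ Ψ ∈ T, IsCMTypeWith ρ Ψ)
    (huniq : ∀ Ψ : Set E, IsCMTypeWith ρ Ψ → ∃! Ψ₀, Ψ₀ ∈ T ∧ Ψ ∈ MulAction.orbit G Ψ₀) :
    T.card ≤ 2 ^ (Nat.card E / 2) ∧ 2 ^ (Nat.card E / 2) ≤ T.card * Nat.card G := by
  rw [← h.sum_card_orbit_eq_two_pow hT huniq]
  constructor
  · rw [Finset.card_eq_sum_ones]
    refine Finset.sum_le_sum fun Ψ _ => ?_
    haveI : Nonempty (MulAction.orbit G Ψ) := ⟨⟨Ψ, MulAction.mem_orbit_self Ψ⟩⟩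
    exact Nat.card_pos
  · rw [mul_comm, Finset.card_eq_sum_ones, Finset.mul_sum, mul_one]
    refine Finset.sum_le_sum fun Ψ _ => ?_
    exact Nat.card_le_card_of_surjective (fun g : G => (⟨g • Ψ, MulAction.mem_orbit Ψ g⟩ : MulAction.orbit G Ψ))
      fun ⟨Ψ', hΨ'⟩ => by
        obtain ⟨g, rfl⟩ := MulAction.mem_orbit_iff.1 hΨ'
        exact ⟨g, rfl⟩

/-- Conjugate CM types have stabilisers of the same order (`Stab(gΨ) = g·Stab(Ψ)·g⁻¹`). [folklore] -/
private theorem natCard_stabilizer_smul [Finite G] (g : G) (Ψ : Set E) :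
    Nat.card (MulAction.stabilizer G (g • Ψ)) = Nat.card (MulAction.stabilizer G Ψ) := by
  have h1 := (MulAction.stabilizer G (g • Ψ)).card_mul_index
  have h2 := (MulAction.stabilizer G Ψ).card_mul_index
  rw [MulAction.index_stabilizer, MulAction.orbit_smul] at h1
  rw [MulAction.index_stabilizer] at h2
  haveI : Finite (MulAction.orbit G Ψ) := Finite.Set.finite_range _
  have hpos : 0 < (MulAction.orbit G Ψ).ncard :=
    (Set.ncard_pos (Set.toFinite _)).2 ⟨Ψ, MulAction.mem_orbit_self Ψ⟩
  exact Nat.eq_of_mul_eq_mul_right hpos (h1.trans h2.symm)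

/-- **The number of classes by Burnside–Frobenius** (Kida's Theorem 4.1, first equality, `c(G,H,ρ)·|G| =
Σ_S |r(S)|`, read on `G`-sets): for a system of representatives `T` of the `G`-classes of CM types,
`|T|·|G| = Σ_{Ψ a CM type} |Stab Ψ|` (each class `G·Φ` contributes `|G·Φ|·|Stab Φ| = |G|`).
[cite: Kida2019CountingCMTypes, Thm. 4.1] -/
theorem card_mul_card_eq_sum_card_stabilizer [Finite E] [Finite G] {T : Finset (Set E)}
    (hT : ∀ Ψ ∈ T, IsCMTypeWith ρ Ψ)
    (huniq : ∀ Ψ : Set E, IsCMTypeWith ρ Ψ → ∃! Ψ₀, Ψ₀ ∈ T ∧ Ψ ∈ MulAction.orbit G Ψ₀) :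
    T.card * Nat.card G =
      ∑ Ψ ∈ (Set.toFinite {Ψ : Set E | IsCMTypeWith ρ Ψ}).toFinset, Nat.card (MulAction.stabilizer G Ψ) := by
  classical
  -- the CM types are the disjoint union of the orbits through `T`
  have hU : (Set.toFinite {Ψ : Set E | IsCMTypeWith ρ Ψ}).toFinset =
      T.biUnion fun Φ => (Set.toFinite (MulAction.orbit G Φ)).toFinset := by
    ext Ψ
    simp only [Set.Finite.mem_toFinset, Set.mem_setOf_eq, Finset.mem_biUnion]
    constructor
    · intro hΨ
      obtain ⟨Φ, ⟨hΦT, hΨΦ⟩, -⟩ := huniq Ψ hΨ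
      exact ⟨Φ, hΦT, hΨΦ⟩
    · rintro ⟨Φ, hΦT, hΨΦ⟩
      obtain ⟨g, rfl⟩ := MulAction.mem_orbit_iff.1 hΨΦ
      exact (hT Φ hΦT).smul_set g
  have hdisj : Set.PairwiseDisjoint (T : Set (Set E))
      fun Φ => (Set.toFinite (MulAction.orbit G Φ)).toFinset := by
    intro Φ₁ h₁ Φ₂ h₂ hne
    rw [Function.onFun, Finset.disjoint_left]
    intro Ψ hΨ1 hΨ2
    rw [Set.Finite.mem_toFinset] at hΨ1 hΨ2
    obtain ⟨g, rfl⟩ := MulAction.mem_orbit_iff.1 hΨ1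
    obtain ⟨Φ, -, hu⟩ := huniq _ ((hT Φ₁ h₁).smul_set g)
    exact hne ((hu Φ₁ ⟨h₁, MulAction.mem_orbit _ g⟩).trans (hu Φ₂ ⟨h₂, hΨ2⟩).symm)
  rw [hU, Finset.sum_biUnion hdisj, Finset.card_eq_sum_ones, Finset.sum_mul]
  refine Finset.sum_congr rfl fun Φ _ => ?_
  -- on the class of `Φ` the stabilisers all have `|Stab Φ|` elements, and `|G·Φ|·|Stab Φ| = |G|`
  have hinner : ∑ Ψ ∈ (Set.toFinite (MulAction.orbit G Φ)).toFinset, Nat.card (MulAction.stabilizer G Ψ) =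
      ∑ Ψ ∈ (Set.toFinite (MulAction.orbit G Φ)).toFinset, Nat.card (MulAction.stabilizer G Φ) :=
    Finset.sum_congr rfl fun Ψ hΨ => by
      rw [Set.Finite.mem_toFinset] at hΨ
      obtain ⟨g, rfl⟩ := MulAction.mem_orbit_iff.1 hΨ
      exact natCard_stabilizer_smul g Φ
  rw [hinner, Finset.sum_const, smul_eq_mul, one_mul, ← Set.ncard_eq_toFinset_card _ (Set.toFinite _),
    ← MulAction.index_stabilizer, mul_comm, (MulAction.stabilizer G Φ).card_mul_index]

end IsCMTypeWith

end GroupLevel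

/-! ## §3 Number fields: `Σ_Φ [K′_Φ : ℚ] = 2ⁿ` over the Galois classes of CM types of `K` -/

section FieldLevel

open NumberField
open Literature.AlgebraicGeometry.Motives (CMType)

variable {L : Type} [Field L] [NumberField L] [IsCMField L] [IsGalois ℚ L] {K : Type} [Field K] [NumberField K]
  [IsTotallyComplex K]

/-- In the Galois formulation `(W_L)` (`L ⊇ K` a Galois CM field, `ρ = conjGal`, CM types `Ψ ⊆ Hom(K, L)`), a
totally complex `K` has `2ⁿ` CM types, `2n = [K : ℚ]` (the tree's `CMTypeCount.natCard_cmType` read through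
`cmTypeEquivIsCMTypeWithGal`). [cite: Dodson1984, §1.2 Proposition] -/
theorem natCard_isCMTypeWith_conjGal (j : K →ₐ[ℚ] L) :
    Nat.card {Ψ : Set (K →ₐ[ℚ] L) // IsCMTypeWith (conjGal : L ≃ₐ[ℚ] L) Ψ} = 2 ^ (Module.finrank ℚ K / 2) := by
  obtain ⟨ι⟩ : Nonempty (L →+* ℂ) := inferInstance
  rw [← Nat.card_congr (cmTypeEquivIsCMTypeWithGal j ι), CMTypeCount.natCard_cmType]

omit [IsCMField L] [IsTotallyComplex K] in
/-- `[K′_Φ : ℚ] = (Gal(L/ℚ) : Stab Φ)` («`[L_K : ℚ] = |G|/|K|`, where `L_K` is the reflex field» and `K = r(S)`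
the reflex subgroup = the stabiliser). [cite: Kida2019CountingCMTypes, Rem. 4.3] -/
theorem finrank_reflexField_eq_index_stabilizer (Φ : Set (K →ₐ[ℚ] L)) :
    Module.finrank ℚ (reflexField ℚ L Φ) = (MulAction.stabilizer (L ≃ₐ[ℚ] L) Φ).index := by
  rw [finrank_reflexField_eq_card_orbit, MulAction.index_stabilizer, Nat.card_coe_set_eq]

/-- **THE ORBIT PARTITION OF THE REFLEX DEGREES.** Let `K` be a totally complex number field of degree `2n`,
`L ⊇ K` a Galois CM field, and let `T` be a system of representatives of the `Gal(L/ℚ)`-classes of the CM types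
`Φ ⊆ Hom(K, L)` of `K` (every CM type is `gΦ` for exactly one `Φ ∈ T`).  Then
`Σ_{Φ ∈ T} [K′_Φ : ℚ] = 2ⁿ`, `K′_Φ = reflexField ℚ L Φ` the reflex field: «`[K′ : ℚ]` is also the order of the
orbit of `Φ` under the `G`-action» and the `2ⁿ` types are the disjoint union of the orbits («the general partition
formula for the degrees of the reflex fields»; «the sum of `[L_K : ℚ]` over a representative of the conjugacy
classes … is `2^{½|H\G|}`. This fact was previously noticed by Dodson [1984, p. 5] and Oishi-Tomiyasu [2010,
Lemma 1.4]»). [cite: Dodson1984, §1.3 Remark (p. 5)] [cite: Dodson1984, §4.0 (p. 17)]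
[cite: Kida2019CountingCMTypes, Rem. 4.3] -/
theorem sum_finrank_reflexField_eq_two_pow (j : K →ₐ[ℚ] L) {T : Finset (Set (K →ₐ[ℚ] L))}
    (hT : ∀ Φ ∈ T, IsCMTypeWith (conjGal : L ≃ₐ[ℚ] L) Φ)
    (huniq : ∀ Ψ : Set (K →ₐ[ℚ] L), IsCMTypeWith (conjGal : L ≃ₐ[ℚ] L) Ψ →
      ∃! Φ, Φ ∈ T ∧ Ψ ∈ MulAction.orbit (L ≃ₐ[ℚ] L) Φ) :
    ∑ Φ ∈ T, Module.finrank ℚ (reflexField ℚ L Φ) = 2 ^ (Module.finrank ℚ K / 2) := by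
  simp_rw [finrank_reflexField_eq_card_orbit]
  rw [← IsCMTypeWith.natCard_setOf_eq_sum_card_orbit hT huniq, natCard_isCMTypeWith_conjGal j]

/-- The partition with indices: `Σ_{Φ ∈ T} (Gal(L/ℚ) : Gal(L/K′_Φ)) = 2ⁿ`. [cite: Kida2019CountingCMTypes, Rem. 4.3] -/
theorem sum_index_stabilizer_conjGal_eq_two_pow (j : K →ₐ[ℚ] L) {T : Finset (Set (K →ₐ[ℚ] L))}
    (hT : ∀ Φ ∈ T, IsCMTypeWith (conjGal : L ≃ₐ[ℚ] L) Φ)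
    (huniq : ∀ Ψ : Set (K →ₐ[ℚ] L), IsCMTypeWith (conjGal : L ≃ₐ[ℚ] L) Ψ →
      ∃! Φ, Φ ∈ T ∧ Ψ ∈ MulAction.orbit (L ≃ₐ[ℚ] L) Φ) :
    ∑ Φ ∈ T, (MulAction.stabilizer (L ≃ₐ[ℚ] L) Φ).index = 2 ^ (Module.finrank ℚ K / 2) := by
  simp_rw [← finrank_reflexField_eq_index_stabilizer]
  exact sum_finrank_reflexField_eq_two_pow j hT huniq

omit [IsGalois ℚ L] [IsTotallyComplex K] in
/-- A system of representatives of the Galois classes of CM types of `K` exists.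
[cite: Kida2019CountingCMTypes, Rem. 4.3] -/
theorem exists_orbitTransversal_conjGal :
    ∃ T : Finset (Set (K →ₐ[ℚ] L)), (∀ Φ ∈ T, IsCMTypeWith (conjGal : L ≃ₐ[ℚ] L) Φ) ∧
      ∀ Ψ : Set (K →ₐ[ℚ] L), IsCMTypeWith (conjGal : L ≃ₐ[ℚ] L) Ψ →
        ∃! Φ, Φ ∈ T ∧ Ψ ∈ MulAction.orbit (L ≃ₐ[ℚ] L) Φ :=
  IsCMTypeWith.exists_orbitTransversal

/-- **`[K′_Φ : ℚ] = 2ⁿ` iff `K` has a single class of CM types** (all CM types of `K` are Galois conjugate to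
`Φ`; «Shimura has shown that there exist CM-fields such that the maximal degree `[K′ : ℚ] = 2ⁿ` occurs», «the
case `v = n` gives a single orbit»). [cite: Dodson1984, §5.1.3 Proposition 1 (proof)] -/
theorem finrank_reflexField_eq_two_pow_iff (j : K →ₐ[ℚ] L) {Φ : Set (K →ₐ[ℚ] L)}
    (hΦ : IsCMTypeWith (conjGal : L ≃ₐ[ℚ] L) Φ) :
    Module.finrank ℚ (reflexField ℚ L Φ) = 2 ^ (Module.finrank ℚ K / 2) ↔
      ∀ Ψ : Set (K →ₐ[ℚ] L), IsCMTypeWith (conjGal : L ≃ₐ[ℚ] L) Ψ → ∃ g : L ≃ₐ[ℚ] L, g • Φ = Ψ := by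
  have h2 : 2 ^ (Module.finrank ℚ K / 2) = 2 ^ (Nat.card (K →ₐ[ℚ] L) / 2) := by
    rw [← natCard_isCMTypeWith_conjGal j, hΦ.natCard_setOf_isCMTypeWith]
  rw [finrank_reflexField_eq_card_orbit, h2, hΦ.card_orbit_eq_two_pow_iff_forall]

/-- The number `c` of Galois classes of CM types of `K` satisfies `c ≤ 2ⁿ ≤ c·[L : ℚ]`.
[cite: Kida2019CountingCMTypes, Rem. 4.3] -/
theorem card_le_two_pow_and_two_pow_le_card_mul_finrank (j : K →ₐ[ℚ] L) {T : Finset (Set (K →ₐ[ℚ] L))}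
    (hT : ∀ Φ ∈ T, IsCMTypeWith (conjGal : L ≃ₐ[ℚ] L) Φ)
    (huniq : ∀ Ψ : Set (K →ₐ[ℚ] L), IsCMTypeWith (conjGal : L ≃ₐ[ℚ] L) Ψ →
      ∃! Φ, Φ ∈ T ∧ Ψ ∈ MulAction.orbit (L ≃ₐ[ℚ] L) Φ) :
    T.card ≤ 2 ^ (Module.finrank ℚ K / 2) ∧ 2 ^ (Module.finrank ℚ K / 2) ≤ T.card * Module.finrank ℚ L := by
  obtain ⟨Φ₀, hΦ₀⟩ : ∃ Φ₀ : Set (K →ₐ[ℚ] L), IsCMTypeWith (conjGal : L ≃ₐ[ℚ] L) Φ₀ := by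
    obtain ⟨ι⟩ : Nonempty (L →+* ℂ) := inferInstance
    obtain ⟨Θ⟩ : Nonempty (CMType K) := CMTypeCount.nonempty_cmType_iff_isTotallyComplex.2 inferInstance
    exact ⟨_, isCMTypeWith_conjGal_algValuedIn ι Θ⟩
  have h2 : 2 ^ (Module.finrank ℚ K / 2) = 2 ^ (Nat.card (K →ₐ[ℚ] L) / 2) := by
    rw [← natCard_isCMTypeWith_conjGal j, hΦ₀.natCard_setOf_isCMTypeWith]
  rw [h2, ← IsGalois.card_aut_eq_finrank ℚ L]
  exact hΦ₀.card_le_two_pow_and_two_pow_le_card_mul hT huniq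

omit [IsTotallyComplex K] in
/-- **The number `c` of Galois classes of CM types of `K`** (Kida's Theorem 4.1 «`c(G,H,ρ) = |G|⁻¹ Σ_{K ∈ 𝓗}
|K|·|𝒮̄(H) ∩ ℛ(K)|`», i.e. `c·|G| = Σ_S |r(S)|`, with `|r(S)| = |Gal(L/K′_S)| = [L : K′_S]`): for a system of
representatives `T`, **`|T|·[L : ℚ] = Σ_{Φ a CM type of K} [L : K′_Φ]`**. [cite: Kida2019CountingCMTypes, Thm. 4.1] -/
theorem card_mul_finrank_eq_sum_finrank_reflexField {T : Finset (Set (K →ₐ[ℚ] L))}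
    (hT : ∀ Φ ∈ T, IsCMTypeWith (conjGal : L ≃ₐ[ℚ] L) Φ)
    (huniq : ∀ Ψ : Set (K →ₐ[ℚ] L), IsCMTypeWith (conjGal : L ≃ₐ[ℚ] L) Ψ →
      ∃! Φ, Φ ∈ T ∧ Ψ ∈ MulAction.orbit (L ≃ₐ[ℚ] L) Φ) :
    T.card * Module.finrank ℚ L =
      ∑ Φ ∈ (Set.toFinite {Φ : Set (K →ₐ[ℚ] L) | IsCMTypeWith (conjGal : L ≃ₐ[ℚ] L) Φ}).toFinset,
        Module.finrank (reflexField ℚ L Φ) L := by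
  rw [← IsGalois.card_aut_eq_finrank ℚ L, IsCMTypeWith.card_mul_card_eq_sum_card_stabilizer hT huniq]
  refine Finset.sum_congr rfl fun Φ _ => ?_
  rw [reflexField_eq_fixedField]
  exact (IntermediateField.finrank_fixedField_eq_card _).symm

/-! ### The same for the tree's complex CM types `Φ : CMType K`, read in `L` through `ι : L → ℂ` -/

/-- **The orbit partition for complex CM types.** For `ι : L → ℂ` the complex CM types `Φ : CMType K` are read
in `L` as `Φ_L = algValuedIn ι Φ` (the tree's dictionary `cmTypeEquivIsCMTypeWithGal`); if `T` is a system of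
representatives of the complex CM types of `K` up to Galois conjugacy (`Ψ_L = gΦ_L` for exactly one `Φ ∈ T`),
then `Σ_{Φ ∈ T} [K*_Φ : ℚ] = 2ⁿ` with `K*_Φ = reflexField ℚ L Φ_L`. [cite: Dodson1984, §1.3 Remark (p. 5)]
[cite: Kida2019CountingCMTypes, Rem. 4.3] -/
theorem sum_finrank_reflexField_algValuedIn_eq_two_pow (j : K →ₐ[ℚ] L) (ι : L →+* ℂ) {T : Finset (CMType K)}
    (huniq : ∀ Ψ : CMType K, ∃! Φ, Φ ∈ T ∧
      algValuedIn ι Ψ.1 ∈ MulAction.orbit (L ≃ₐ[ℚ] L) (algValuedIn ι Φ.1)) :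
    ∑ Φ ∈ T, Module.finrank ℚ (reflexField ℚ L (algValuedIn ι Φ.1)) = 2 ^ (Module.finrank ℚ K / 2) := by
  classical
  have hinj : Function.Injective (fun Φ : CMType K => algValuedIn ι Φ.1) := fun Φ₁ Φ₂ h12 =>
    (cmTypeEquivIsCMTypeWithGal j ι).injective (Subtype.ext h12)
  rw [← Finset.sum_image (f := fun Ψ => Module.finrank ℚ (reflexField ℚ L Ψ))
    (fun Φ₁ _ Φ₂ _ h12 => hinj h12)]
  apply sum_finrank_reflexField_eq_two_pow j
  · intro Ψ hΨ
    obtain ⟨Φ, -, rfl⟩ := Finset.mem_image.1 hΨ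
    exact isCMTypeWith_conjGal_algValuedIn ι Φ
  · intro Ψ hΨ
    have hΨeq : algValuedIn ι ((cmTypeEquivIsCMTypeWithGal j ι).symm ⟨Ψ, hΨ⟩).1 = Ψ :=
      congrArg Subtype.val ((cmTypeEquivIsCMTypeWithGal j ι).apply_symm_apply ⟨Ψ, hΨ⟩)
    obtain ⟨Φ, ⟨hΦT, hΦ⟩, huΦ⟩ := huniq ((cmTypeEquivIsCMTypeWithGal j ι).symm ⟨Ψ, hΨ⟩)
    rw [hΨeq] at hΦ
    refine ⟨algValuedIn ι Φ.1, ⟨Finset.mem_image.2 ⟨Φ, hΦT, rfl⟩, hΦ⟩, ?_⟩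
    rintro Ψ' ⟨hΨ'T, hΨΨ'⟩
    obtain ⟨Φ', hΦ'T, rfl⟩ := Finset.mem_image.1 hΨ'T
    exact congrArg (fun Θ : CMType K => algValuedIn ι Θ.1) (huΦ Φ' ⟨hΦ'T, by rwa [hΨeq]⟩)

/-- **`[K*_Φ : ℚ] = 2ⁿ` iff all complex CM types of `K` are Galois conjugate to `Φ`.**
[cite: Dodson1984, §5.1.3 Proposition 1 (proof)] -/
theorem finrank_reflexField_algValuedIn_eq_two_pow_iff (j : K →ₐ[ℚ] L) (ι : L →+* ℂ) (Φ : CMType K) :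
    Module.finrank ℚ (reflexField ℚ L (algValuedIn ι Φ.1)) = 2 ^ (Module.finrank ℚ K / 2) ↔
      ∀ Ψ : CMType K, ∃ g : L ≃ₐ[ℚ] L, g • algValuedIn ι Φ.1 = algValuedIn ι Ψ.1 := by
  rw [finrank_reflexField_eq_two_pow_iff j (isCMTypeWith_conjGal_algValuedIn ι Φ)]
  constructor
  · intro hall Ψ
    exact hall _ (isCMTypeWith_conjGal_algValuedIn ι Ψ)
  · intro hall Ψ hΨ
    have hΨeq : algValuedIn ι ((cmTypeEquivIsCMTypeWithGal j ι).symm ⟨Ψ, hΨ⟩).1 = Ψ :=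
      congrArg Subtype.val ((cmTypeEquivIsCMTypeWithGal j ι).apply_symm_apply ⟨Ψ, hΨ⟩)
    obtain ⟨g, hg⟩ := hall ((cmTypeEquivIsCMTypeWithGal j ι).symm ⟨Ψ, hΨ⟩)
    exact ⟨g, hg.trans hΨeq⟩

end FieldLevel

/-! ## §4 One Galois class ⟹ every CM type of `K` is nondegenerate ⟹ no exceptional Hodge classes

Ribet's Corollary (3.6) («Suppose that we have `d′ = 2^{d−1}`.  Then `(E, S)` is non-degenerate», the tree's
`isNondegenerate_of_finrank_reflexField_eq`) combined with `finrank_reflexField_eq_two_pow_iff`: the maximal reflex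
degree `[K′_Φ : ℚ] = 2ⁿ` MEANS that `K` has a single Galois class of CM types, so for such `K` every CM type is
nondegenerate and (White–Hazama, the tree's `Pohlmann1968/NondegenerateCMTypeHodgeConjecture`) no power of a CM
abelian variety with CM by `K` carries an exceptional Hodge class. -/

section SingleClass

open NumberField
open Literature.AlgebraicGeometry
open Literature.AlgebraicGeometry.Motives (CMType)

variable {L : Type} [Field L] [NumberField L] {K : Type} [Field K] [NumberField K]

/-- **`Aut(ℂ)`-conjugate complex types are `Gal(L/ℚ)`-conjugate in `L`**: if `τΦ = Ψ` for some `τ ∈ Aut(ℂ)` then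
`σΦ_L = Ψ_L` for some `σ ∈ Gal(L/ℚ)` (every `τ` acts on `Hom(K, ℂ) ≅ Hom_ℚ(K, L)` through some `σ`, the tree's
`exists_algEquiv_forall_algHomEquivRingHomOfNormal_smul`). [cite: Shimura1998, §32.7] -/
theorem exists_smul_algValuedIn_eq_of_smul_eq [Normal ℚ L] (j : K →ₐ[ℚ] L) (ι : L →+* ℂ)
    {Φ Ψ : Set (K →+* ℂ)} {τ : ℂ ≃+* ℂ} (h : τ • Φ = Ψ) :
    ∃ σ : L ≃ₐ[ℚ] L, σ • algValuedIn ι Φ = algValuedIn ι Ψ := by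
  obtain ⟨σ, hσ⟩ := exists_algEquiv_forall_algHomEquivRingHomOfNormal_smul j ι τ
  refine ⟨σ, Set.ext fun χ => ?_⟩
  have hχ : algHomEquivRingHomOfNormal j ι (σ⁻¹ • χ) = τ⁻¹ • algHomEquivRingHomOfNormal j ι χ := by
    rw [eq_inv_smul_iff, ← hσ, smul_inv_smul]
  rw [Set.mem_smul_set_iff_inv_smul_mem, mem_algValuedIn_iff, mem_algValuedIn_iff, ← h,
    ← algHomEquivRingHomOfNormal_apply j ι, ← algHomEquivRingHomOfNormal_apply j ι, hχ,
    Set.mem_smul_set_iff_inv_smul_mem]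

/-- Conversely `Gal(L/ℚ)`-conjugate readings come from `Aut(ℂ)`-conjugate complex types.
[cite: Shimura1998, §32.7] -/
theorem exists_smul_eq_of_smul_algValuedIn_eq [Normal ℚ L] (j : K →ₐ[ℚ] L) (ι : L →+* ℂ)
    {Φ Ψ : Set (K →+* ℂ)} {σ : L ≃ₐ[ℚ] L} (h : σ • algValuedIn ι Φ = algValuedIn ι Ψ) :
    ∃ τ : ℂ ≃+* ℂ, τ • Φ = Ψ := by
  obtain ⟨τ, hτ⟩ := exists_ringEquiv_forall_algHomEquivRingHomOfNormal_smul j ι σ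
  refine ⟨τ, Set.ext fun x => ?_⟩
  obtain ⟨χ, rfl⟩ := (algHomEquivRingHomOfNormal j ι).surjective x
  have hχ : algHomEquivRingHomOfNormal j ι (σ⁻¹ • χ) = τ⁻¹ • algHomEquivRingHomOfNormal j ι χ := by
    rw [eq_inv_smul_iff, ← hτ, smul_inv_smul]
  have h1 : χ ∈ algValuedIn ι Ψ ↔ σ⁻¹ • χ ∈ algValuedIn ι Φ := by
    rw [← h, Set.mem_smul_set_iff_inv_smul_mem]
  rw [mem_algValuedIn_iff, mem_algValuedIn_iff, ← algHomEquivRingHomOfNormal_apply j ι,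
    ← algHomEquivRingHomOfNormal_apply j ι, hχ] at h1
  rw [Set.mem_smul_set_iff_inv_smul_mem]
  exact h1.symm

variable [IsCMField L] [IsGalois ℚ L] [IsCMField K]

/-- **One Galois class ⟹ nondegenerate** (reading in `L`): if every complex CM type of `K` is `Gal(L/ℚ)`-conjugate
to `Φ` in `L`, then `Φ` is nondegenerate — `[K*_Φ : ℚ] = 2ⁿ` by `finrank_reflexField_algValuedIn_eq_two_pow_iff`
and Ribet's Cor. (3.6). [cite: Ribet1980, §3 Cor. (3.6) (p. 87)] [cite: Dodson1984, §1.3 Remark (p. 5)] -/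
theorem isNondegenerate_of_forall_exists_smul_algValuedIn_eq (j : K →ₐ[ℚ] L) (ι : L →+* ℂ) (Φ : CMType K)
    (hone : ∀ Ψ : CMType K, ∃ g : L ≃ₐ[ℚ] L, g • algValuedIn ι Φ.1 = algValuedIn ι Ψ.1) :
    Pohlmann1968.IsNondegenerate Φ :=
  isNondegenerate_of_finrank_reflexField_eq j ι Φ ((finrank_reflexField_algValuedIn_eq_two_pow_iff j ι Φ).2 hone)

/-- **One Galois class ⟹ EVERY CM type of `K` is nondegenerate**: if all complex CM types of `K` are
`Aut(ℂ)`-conjugate to one of them, `Φ`, then every CM type `Ψ` of `K` is nondegenerate (each `Ψ` is then conjugate to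
all the others as well).  `L` is any Galois CM field receiving `K` (e.g. a normal closure); the conclusion does not
mention it. [cite: Ribet1980, §3 Cor. (3.6) (p. 87)] [cite: Dodson1984, §5.1.3 Proposition 1 (proof)] -/
theorem isNondegenerate_of_forall_exists_smul_eq (j : K →ₐ[ℚ] L) {Φ : CMType K}
    (hone : ∀ Ψ : CMType K, ∃ τ : ℂ ≃+* ℂ, τ • Φ.1 = Ψ.1) (Ψ : CMType K) :
    Pohlmann1968.IsNondegenerate Ψ := by
  obtain ⟨ι⟩ : Nonempty (L →+* ℂ) := inferInstance
  refine isNondegenerate_of_forall_exists_smul_algValuedIn_eq j ι Ψ fun Θ => ?_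
  obtain ⟨σ₁, h₁⟩ := exists_smul_algValuedIn_eq_of_smul_eq j ι (Classical.choose_spec (hone Ψ))
  obtain ⟨σ₂, h₂⟩ := exists_smul_algValuedIn_eq_of_smul_eq j ι (Classical.choose_spec (hone Θ))
  exact ⟨σ₂ * σ₁⁻¹, by rw [mul_smul, ← h₁, inv_smul_smul, h₂]⟩

/-- The same criterion with the maximal reflex degree as hypothesis, for every type at once: if ONE complex CM type
`Φ` of `K` has `[K*_Φ : ℚ] = 2ⁿ` then ALL CM types of `K` are nondegenerate (they form the single class of `Φ`).
[cite: Ribet1980, §3 Cor. (3.6) (p. 87)] [cite: Dodson1984, §5.1.3 Proposition 1 (proof)] -/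
theorem isNondegenerate_of_finrank_reflexField_eq_two_pow (j : K →ₐ[ℚ] L) (ι : L →+* ℂ) {Φ : CMType K}
    (hΦ : Module.finrank ℚ (reflexField ℚ L (algValuedIn ι Φ.1)) = 2 ^ (Module.finrank ℚ K / 2)) (Ψ : CMType K) :
    Pohlmann1968.IsNondegenerate Ψ := by
  have hone := (finrank_reflexField_algValuedIn_eq_two_pow_iff j ι Φ).1 hΦ
  refine isNondegenerate_of_forall_exists_smul_algValuedIn_eq j ι Ψ fun Θ => ?_
  obtain ⟨σ₁, h₁⟩ := hone Ψ
  obtain ⟨σ₂, h₂⟩ := hone Θ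
  exact ⟨σ₂ * σ₁⁻¹, by rw [mul_smul, ← h₁, inv_smul_smul, h₂]⟩

end SingleClass

/-! ### … and on abelian varieties: the Hodge ring of every power is generated by divisor classes -/

section AbelianVariety

open NumberField CategoryTheory
open Literature.AlgebraicGeometry
open Literature.AlgebraicGeometry.Motives (AbelianVariety CMType)
open Literature.AlgebraicGeometry.HodgeTheory
open Literature.AlgebraicGeometry.ComplexMultiplication (IsCMTypeRealisation)
open Literature.AlgebraicGeometry.VanGeemen1994 (hodgeClassSpan)
open Literature.Barriers.HodgeConjecture (divisorClassesSpan)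

variable {K : Type} [Field K] [NumberField K] [IsCMField K]
variable {L : Type} [Field L] [NumberField L] [IsCMField L] [IsGalois ℚ L]
variable {Φ : CMType K} {A : AbelianVariety ℂ} {i : 𝓞 K →+* End A} {θ : K →+* Module.End ℂ (complexBetti A.X 1)}

/-- **A single Galois class of CM types ⟹ `Bᵐ(Aᵏ) ⊗ ℂ = Dᵐ(Aᵏ) ⊗ ℂ`** for every abelian variety `A` of any CM type
`(K; Φ)` and all `k, m`: all CM types of `K` are nondegenerate (`isNondegenerate_of_forall_exists_smul_eq`), and a
nondegenerate type carries no exceptional Hodge classes on any power (the tree's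
`IsNondegenerate.hodgeClassSpan_pow_eq_divisorClassesSpan`). [cite: Ribet1980, §3 Cor. (3.6) (p. 87)]
[cite: Gordon1999HodgeAVSurvey, Thm. 6.4 and §9.3] -/
theorem hodgeClassSpan_pow_eq_divisorClassesSpan_of_forall_exists_smul_eq (j : K →ₐ[ℚ] L) {Φ₀ : CMType K}
    (hone : ∀ Ψ : CMType K, ∃ τ : ℂ ≃+* ℂ, τ • Φ₀.1 = Ψ.1) (hA : IsCMTypeRealisation Φ A i θ) (k m : ℕ) :
    hodgeClassSpan (⨁ fun _ : Fin k => A).dim (⨁ fun _ : Fin k => A).X m =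
      divisorClassesSpan (⨁ fun _ : Fin k => A).X (⨁ fun _ : Fin k => A).dim m :=
  (isNondegenerate_of_forall_exists_smul_eq j hone Φ).hodgeClassSpan_pow_eq_divisorClassesSpan hA k m

/-- **A single Galois class of CM types ⟹ the Hodge conjecture for every power of every abelian variety with CM by
`K`**, of any CM type, unconditionally (nondegenerate types: `IsNondegenerate.hodgeConjectureFor_pow`).
[cite: Ribet1980, §3 Cor. (3.6) (p. 87)] [cite: Gordon1999HodgeAVSurvey, Thm. 6.4 and §9.3] -/
theorem hodgeConjectureFor_pow_of_forall_exists_smul_eq (j : K →ₐ[ℚ] L) {Φ₀ : CMType K}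
    (hone : ∀ Ψ : CMType K, ∃ τ : ℂ ≃+* ℂ, τ • Φ₀.1 = Ψ.1) (hA : IsCMTypeRealisation Φ A i θ) (k : ℕ) :
    HodgeConjectureFor (⨁ fun _ : Fin k => A).dim (⨁ fun _ : Fin k => A).X :=
  (isNondegenerate_of_forall_exists_smul_eq j hone Φ).hodgeConjectureFor_pow hA k

/-- … and for `A` itself. [cite: Gordon1999HodgeAVSurvey, §9.3] -/
theorem hodgeConjectureFor_of_forall_exists_smul_eq (j : K →ₐ[ℚ] L) {Φ₀ : CMType K}
    (hone : ∀ Ψ : CMType K, ∃ τ : ℂ ≃+* ℂ, τ • Φ₀.1 = Ψ.1) (hA : IsCMTypeRealisation Φ A i θ) :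
    HodgeConjectureFor A.dim A.X :=
  (isNondegenerate_of_forall_exists_smul_eq j hone Φ).hodgeConjectureFor hA

end AbelianVariety

end Literature.NumberTheory.ComplexMultiplication
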